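import Summits.ValiantsHypothesis.ValiantsHypothesis.Theorems.KPlusLogSqLawTropicalShiftDiamondDomination

/-!
# Route «KPlusLogSqLaw» — DIAMOND, part 3: signs, the chain; **`T(m, K) ≥ (K−3)·m² + 2m` for every `m ≥ 1`, `K ≥ 3`**

HONEST FRAMING.  Proof file (pure theorems), part 3 of the helper chain `--supports` the crux
`Summit.ValiantsHypothesis.ValiantsHypothesis.Theses.KPlusLogSqLaw.TropicalB` (ledger item `stmt-ValiantsHypothesis-19771`, route `KPlusLogSqLaw`;
object-search cell `pub-symmetroid`, seat val-sym-trop-p5 g8, 2026-08-27).  Nothing here asserts `TropicalB`, `WeakLifting`, `KPlusLogSqLaw`,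
`MatrixDescartes` or anything about `VP ≠ VNP`; the family is quadratic in `m` (leading constant `K − 3`), far inside every open question of the
cell (the `K = 4` fork, the window of `TropicalB`).
CONTENTS.  The rungs of a grid term add up to the step (`sum_jcol`, via the era forms `jcol_era0/era1/top` and `sum_range_lvl`), the
last-column incidence of phase `P` is the private one carrying `tau P` (`desig_cterm`), so the grid term of `(P, s)` has sign `(−1)^{st P + s}`
(`termSign_cterm`; `sign σ = (−1)^{n·(P mod m)}` by `ShiftSquare.sign_rot` cancels against `tau`).  The enumeration `grid k` (iterate of `step`)
satisfies `st P + s = k`, `s ≤ a·climb P`, `P ≤ 2m` up to `k = st(2m)` (`grid_inv`), its slopes increase (`th_grid_lt`) and its signs are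
`(−1)^k` (`termSign_grid`); the count is `st(2m) = a·m² + 2m` (`two_st_era0`, `two_st_era1`, `st_top`).  Main results:
* `ShiftDiamond.le_of_tropRootLawAt_succ : TropRootLawAt (n+1) (a+3) B → a(n+1)² + 2(n+1) ≤ B`;
* **`diamond_le_of_tropRootLawAt (a m B) : TropRootLawAt m (a+3) B → a·m² + 2m ≤ B`** — `T(m,K) ≥ (K−3)m² + 2m` for all `m`, `K ≥ 3`:
  `T(m,5) ≥ 2m² + 2m`, `T(m,6) ≥ 3m² + 2m`, `T(m,7) ≥ 4m² + 2m`, …; `T(3,K) ≥ 9K − 21`, `T(4,K) ≥ 16K − 40` (the cell's `m = 3, 4` family floors of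
  record were `max(9K−37, 8K−33, 6K−11)` and `12K − 49`); leading constant `K − 3` against SHIFT-GRID's `≤ (√K − 1)²`.
Reading (no claim beyond the theorems): the diamond type's sumset ceiling is `a·m² + 2m + 1` points, so this sector is exactly solved too (the
ceiling count is not formalised here); `K − 3` is the optimum of the rotation/era mechanism over all stack profiles.  Nothing here bears on
`TropicalB` / `WeakLifting` in their window, the `K = 4` fork, `MatrixDescartes` (stmt-ValiantsHypothesis-18050) or `VP ≠ VNP`.
-/

set_option linter.dupNamespace false
set_option autoImplicit false

namespace Summit.ValiantsHypothesis.ValiantsHypothesis.Theorems.LacunarySymmetroidMatrixDescartes.TropicalCensus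

open Summit.ValiantsHypothesis.ValiantsHypothesis.Theorems.MatrixDescartes.Negative
open scoped BigOperators
open Finset

namespace ShiftDiamond

open ShiftThree (shiftZ)
open ShiftSquare (rot)

variable (a n : ℕ)

/-! ### signs of the grid terms -/

/-- positions of the climbing columns are `< climb P` (helper, restated for the sign count). -/
theorem pcol_lt_climb (P : ℕ) (b : Fin (n + 1)) (hc : hcol n P b = 1) : pcol n P b < climb n P := by
  unfold pcol climb; unfold hcol at hc
  have h := Nat.div_add_mod P (n + 1); have hr := ShiftGrid.mod_lt' n P; have hb := b.isLt
  by_cases hw : n + 1 ≤ (b : ℕ) + P % (n + 1)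
  · rw [if_pos hw] at hc
    have he : P / (n + 1) = 0 := by omega
    rw [he] at h
    have hPn : P ≤ n := by omega
    rw [if_pos hPn, if_pos hPn]; have : P % (n + 1) = P := Nat.mod_eq_of_lt (by omega); omega
  · rw [if_neg hw] at hc
    have he : P / (n + 1) = 1 := by omega
    rw [he] at h
    have hPn : ¬ P ≤ n := by omega
    rw [if_neg hPn, if_neg hPn]; omega

/-- `Σ_{i < c} (s div c + [i < s mod c]) = s` for `c ≥ 1`: the round-robin rungs add up to the step. -/
theorem sum_range_lvl (c s : ℕ) (hc : 0 < c) : ∑ i ∈ Finset.range c, lvl c s i = s := by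
  unfold lvl
  rw [Finset.sum_add_distrib, Finset.sum_const, Finset.card_range, smul_eq_mul]
  have hmod : s % c ≤ c := (Nat.mod_lt s hc).le
  have h2 : ∑ i ∈ Finset.range c, (if i < s % c then 1 else 0) = s % c := by
    rw [← Finset.sum_range_add_sum_Ico _ hmod]
    rw [Finset.sum_congr rfl (fun i hi => if_pos (Finset.mem_range.mp hi)),
      Finset.sum_congr rfl (fun i hi => if_neg (not_lt.mpr (Finset.mem_Ico.mp hi).1))]
    simp
  rw [h2]
  exact Nat.div_add_mod s c

/-- era 0 (`P ≤ n`): the rung of column `b` is the round-robin level of position `b + P − m` if the column wraps, else `0`. -/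
theorem jcol_era0 (P s : ℕ) (hPn : P ≤ n) (hs : s ≤ a * climb n P) (b : Fin (n + 1)) :
    jcol a n P s b = if n + 1 ≤ (b : ℕ) + P then lvl P s ((b : ℕ) + P - (n + 1)) else 0 := by
  have hb := b.isLt
  have hmod : P % (n + 1) = P := Nat.mod_eq_of_lt (by omega)
  have he : P / (n + 1) = 0 := Nat.div_eq_of_lt (by omega)
  have hcl : climb n P = P := by unfold climb; rw [if_pos hPn]
  unfold jcol hcol pcol
  rw [hmod, he, hcl, if_pos hPn]
  by_cases hw : n + 1 ≤ (b : ℕ) + P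
  · have hle : lvl P s ((b : ℕ) + P - (n + 1)) ≤ a := lvl_le a _ _ (hcl ▸ hs) _ (by omega)
    simp [hw, min_eq_right hle]
  · simp [hw]

/-- the top phase has high digit `2` everywhere. -/
theorem hcol_top (b : Fin (n + 1)) : hcol n (2 * (n + 1)) b = 2 := by
  unfold hcol
  have hb := b.isLt
  rw [Nat.mul_comm, Nat.mul_div_cancel_left 2 (by omega : 0 < n + 1), Nat.mul_mod_right]
  rw [if_neg (by omega)]

/-- era 1 (`m ≤ P < 2m`): the rung of column `b` is the round-robin level of position `b` if `b < climb P`, else `0`. -/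
theorem jcol_era1 (P s : ℕ) (hPn : ¬ P ≤ n) (hP : P < 2 * (n + 1)) (hs : s ≤ a * climb n P) (b : Fin (n + 1)) :
    jcol a n P s b = if (b : ℕ) < climb n P then lvl (climb n P) s (b : ℕ) else 0 := by
  have hb := b.isLt
  have h := Nat.div_add_mod P (n + 1)
  have hr := ShiftGrid.mod_lt' n P
  have he : P / (n + 1) = 1 := by
    have h1 : 1 ≤ P / (n + 1) := (Nat.one_le_div_iff (by omega)).mpr (by omega)
    have h2 : P / (n + 1) < 2 := Nat.div_lt_of_lt_mul (by linarith)
    omega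
  rw [he] at h
  have hcl : climb n P = 2 * (n + 1) - P := by unfold climb; rw [if_neg hPn]
  unfold jcol hcol pcol
  rw [he, if_neg hPn]
  by_cases hw : n + 1 ≤ (b : ℕ) + P % (n + 1)
  · have hbc : ¬ (b : ℕ) < climb n P := by rw [hcl]; omega
    simp [hw, hbc]
  · have hbc : (b : ℕ) < climb n P := by rw [hcl]; omega
    have hle : lvl (climb n P) s (b : ℕ) ≤ a := lvl_le a _ _ hs _ hbc
    simp [hw, hbc, min_eq_right hle]

/-- era 2 (`P = 2m`): no rungs. -/
theorem jcol_top (s : ℕ) (b : Fin (n + 1)) : jcol a n (2 * (n + 1)) s b = 0 := by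
  unfold jcol
  rw [hcol_top, if_neg (by decide)]

/-- **the rungs of a grid term add up to the step**: `Σ_b jcol P s b = s` (`P ≤ 2m`, `s ≤ a·climb P`). -/
theorem sum_jcol (P s : ℕ) (hP : P ≤ 2 * (n + 1)) (hs : s ≤ a * climb n P) : ∑ b : Fin (n + 1), jcol a n P s b = s := by
  by_cases hPn : P ≤ n
  · rw [Finset.sum_congr rfl (fun b _ => jcol_era0 a n P s hPn hs b)]
    rw [Fin.sum_univ_eq_sum_range (fun i : ℕ => if n + 1 ≤ i + P then lvl P s (i + P - (n + 1)) else 0) (n + 1)]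
    rw [← Finset.sum_range_add_sum_Ico _ (show n + 1 - P ≤ n + 1 by omega)]
    rw [Finset.sum_congr rfl (fun i hi => if_neg (by have := Finset.mem_range.mp hi; omega)),
      Finset.sum_const_zero, zero_add, Finset.sum_Ico_eq_sum_range, show n + 1 - (n + 1 - P) = P by omega]
    rw [Finset.sum_congr rfl (fun i hi => by
      rw [if_pos (by have := Finset.mem_range.mp hi; omega), show n + 1 - P + i + P - (n + 1) = i by omega])]
    rcases Nat.eq_zero_or_pos P with hP0 | hP0
    · subst hP0
      have hcl : climb n 0 = 0 := by unfold climb; simp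
      rw [hcl] at hs
      have hs0 : s = 0 := by omega
      subst hs0; simp
    · exact sum_range_lvl P s hP0
  · rcases Nat.lt_or_ge P (2 * (n + 1)) with hP2 | hP2
    · rw [Finset.sum_congr rfl (fun b _ => jcol_era1 a n P s hPn hP2 hs b)]
      rw [Fin.sum_univ_eq_sum_range (fun i : ℕ => if i < climb n P then lvl (climb n P) s i else 0) (n + 1)]
      have hcle : climb n P ≤ n + 1 := by unfold climb; rw [if_neg hPn]; omega
      rw [← Finset.sum_range_add_sum_Ico _ hcle]
      rw [Finset.sum_congr rfl (fun i hi => if_pos (Finset.mem_range.mp hi)),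
        Finset.sum_congr rfl (fun i hi => if_neg (by have := (Finset.mem_Ico.mp hi).1; omega)),
        Finset.sum_const_zero, add_zero]
      rcases Nat.eq_zero_or_pos (climb n P) with hc0 | hc0
      · rw [hc0] at hs ⊢
        have hs0 : s = 0 := by omega
        subst hs0; simp
      · exact sum_range_lvl _ s hc0
    · have hP2' : P = 2 * (n + 1) := le_antisymm hP hP2
      subst hP2'
      rw [Finset.sum_congr rfl (fun b _ => jcol_top a n s b)]
      have hcl : climb n (2 * (n + 1)) = 0 := by unfold climb; rw [if_neg (by omega)]; omega
      rw [hcl] at hs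
      have hs0 : s = 0 := by omega
      subst hs0; simp

/-- the private incidence of phase `P` sits in the last column: `desig` of the grid incidence there is `P`. -/
theorem desig_cterm (P s : ℕ) (hP : P ≤ 2 * (n + 1)) :
    desig a n (rot n (P % (n + 1)) (Fin.last n)) (lam a n P s (Fin.last n)) = P := by
  unfold desig
  rw [hi_lam a n P s hP]
  unfold hcol
  have h := Nat.div_add_mod P (n + 1)
  have hr := ShiftGrid.mod_lt' n P
  have hv := ShiftSquare.rot_val n (P % (n + 1)) hr.le (Fin.last n)
  rw [Fin.val_last] at hv
  by_cases hr1 : 1 ≤ P % (n + 1)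
  · rw [if_pos (by omega)] at hv
    have hlt : ((rot n (P % (n + 1)) (Fin.last n) : Fin (n + 1)) : ℕ) < n := by rw [hv]; omega
    rw [if_pos (show n + 1 ≤ (Fin.last n : ℕ) + P % (n + 1) by rw [Fin.val_last]; omega), if_pos hlt, if_pos hlt, hv]
    have e1 : P / (n + 1) + 1 - 1 = P / (n + 1) := Nat.add_sub_cancel _ _
    rw [e1]
    have e2 : n + P % (n + 1) - (n + 1) + 1 = P % (n + 1) := by omega
    rw [e2]
    exact Nat.div_add_mod' P (n + 1)
  · rw [if_neg (by omega)] at hv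
    have hnlt : ¬ ((rot n (P % (n + 1)) (Fin.last n) : Fin (n + 1)) : ℕ) < n := by rw [hv]; omega
    rw [if_neg (show ¬ n + 1 ≤ (Fin.last n : ℕ) + P % (n + 1) by rw [Fin.val_last]; omega), if_neg hnlt, if_neg hnlt]
    have hm0 : P % (n + 1) = 0 := by omega
    have hd := Nat.div_add_mod' P (n + 1)
    rw [hm0, Nat.add_zero] at hd
    simp only [Nat.add_zero, Nat.sub_zero]
    exact hd

/-- **sign of the grid term**: `(−1)^{st P + s}` (`P ≤ 2m`, `s ≤ a·climb P`). -/
theorem termSign_cterm (P s : ℕ) (hP : P ≤ 2 * (n + 1)) (hs : s ≤ a * climb n P) :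
    termSign (ee a n) (cterm a n P s) = (-1) ^ (st a n P + s) := by
  unfold termSign cterm ee
  dsimp only
  rw [Finset.prod_mul_distrib, Finset.prod_pow_eq_pow_sum]
  rw [Finset.sum_congr rfl (fun b _ => lo_lam a n P s b), sum_jcol a n P s hP hs]
  rw [Finset.prod_eq_single (Fin.last n) (fun b _ hb => by
        rw [if_neg (fun h => hb (Fin.ext (by rw [h, Fin.val_last])))])
      (fun h => absurd (Finset.mem_univ _) h)]
  rw [if_pos (Fin.val_last n), desig_cterm a n P s hP, ShiftSquare.sign_rot]
  unfold tau
  rw [← pow_add, ← pow_add, neg_one_pow_eq_pow_mod_two, neg_one_pow_eq_pow_mod_two (R := ℤ) (st a n P + s)]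
  congr 1
  omega

/-! ### the chain: enumeration of the phases -/

/-- `st` is strictly increasing by steps `a·climb P + 1 ≥ 1`. -/
theorem st_succ (P : ℕ) : st a n (P + 1) = st a n P + (a * climb n P + 1) := rfl

/-- the grid starts at `(0, 0)`. -/
theorem grid_zero : grid a n 0 = (0, 0) := rfl

/-- one step of the enumeration. -/
theorem grid_succ (k : ℕ) : grid a n (k + 1) = step a n (grid a n k) :=
  Function.iterate_succ_apply' _ _ _

/-- **grid invariant**: up to the last index the `k`-th point `(P, s)` satisfies `st P + s = k`, `s ≤ a·climb P`, `P ≤ 2m`. -/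
theorem grid_inv (k : ℕ) (hk : k ≤ st a n (2 * (n + 1))) :
    st a n (grid a n k).1 + (grid a n k).2 = k ∧ (grid a n k).2 ≤ a * climb n (grid a n k).1 ∧ (grid a n k).1 ≤ 2 * (n + 1) := by
  induction k with
  | zero => simp [grid_zero, st]
  | succ k ih =>
    obtain ⟨h1, h2, h3⟩ := ih (Nat.le_of_succ_le hk)
    rw [grid_succ]
    unfold step
    by_cases h : (grid a n k).2 < a * climb n (grid a n k).1
    · rw [if_pos h]
      exact ⟨by dsimp only; omega, by dsimp only; omega, h3⟩
    · rw [if_neg h]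
      dsimp only
      have hs : (grid a n k).2 = a * climb n (grid a n k).1 := le_antisymm h2 (not_lt.mp h)
      refine ⟨by rw [st_succ]; omega, Nat.zero_le _, ?_⟩
      -- the phase index cannot pass `2m` before the last index
      by_contra hcon
      have hP : (grid a n k).1 = 2 * (n + 1) := by omega
      have hcl : climb n (2 * (n + 1)) = 0 := by unfold climb; rw [if_neg (by omega)]; omega
      rw [hP, hcl] at hs
      rw [hP] at h1
      omega

/-- the slopes increase along the grid. -/
theorem th_grid_lt (k : ℕ) (hk : k + 1 ≤ st a n (2 * (n + 1))) :
    th a n (grid a n k).1 (grid a n k).2 < th a n (grid a n (k + 1)).1 (grid a n (k + 1)).2 := by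
  obtain ⟨_, h2, h3⟩ := grid_inv a n k (Nat.le_of_succ_le hk)
  rw [grid_succ]
  unfold step th
  have hW := width_cast a n
  by_cases h : (grid a n k).2 < a * climb n (grid a n k).1
  · rw [if_pos h]; dsimp only; push_cast; linarith
  · rw [if_neg h]; dsimp only; push_cast
    have hcl : climb n (grid a n k).1 ≤ n + 1 := by unfold climb; split_ifs <;> omega
    have hs : ((grid a n k).2 : ℤ) ≤ (a : ℤ) * (n + 1) := by
      have : (grid a n k).2 ≤ a * (n + 1) := h2.trans (Nat.mul_le_mul_left _ hcl)
      exact_mod_cast this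
    nlinarith

/-- the term signs alternate along the grid: the `k`-th sign is `(−1)^k`. -/
theorem termSign_grid (k : ℕ) (hk : k ≤ st a n (2 * (n + 1))) :
    termSign (ee a n) (cterm a n (grid a n k).1 (grid a n k).2) = (-1) ^ k := by
  obtain ⟨h1, h2, h3⟩ := grid_inv a n k hk
  rw [termSign_cterm a n _ _ h3 h2, h1]

/-- closed form of the cumulative count in era 0: `2·st P + a·P = a·P² + 2P` (`P ≤ m`). -/
theorem two_st_era0 (P : ℕ) (hP : P ≤ n + 1) : 2 * st a n P + a * P = a * P ^ 2 + 2 * P := by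
  induction P with
  | zero => simp [st]
  | succ P ih =>
    have ih' := ih (by omega)
    have hcl : climb n P = P := by unfold climb; rw [if_pos (by omega)]
    rw [st_succ, hcl]
    nlinarith [ih']

/-- closed form in era 1: `2·st(m + r) + a·r² = a·n·m + 2m + 2a·r·m + a·r + 2r` (`r ≤ m`). -/
theorem two_st_era1 (r : ℕ) (hr : r ≤ n + 1) :
    2 * st a n (n + 1 + r) + a * r ^ 2 = a * n * (n + 1) + 2 * (n + 1) + 2 * a * r * (n + 1) + a * r + 2 * r := by
  induction r with
  | zero =>
    have h0 := two_st_era0 a n (n + 1) le_rfl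
    simp only [Nat.add_zero, pow_two] at h0 ⊢
    nlinarith [h0]
  | succ r ih =>
    have ih' := ih (by omega)
    have hcl : climb n (n + 1 + r) = n + 1 - r := by unfold climb; rw [if_neg (by omega)]; omega
    rw [show n + 1 + (r + 1) = (n + 1 + r) + 1 by ring, st_succ, hcl]
    have e : (n + 1 - r) + r = n + 1 := by omega
    zify [show r ≤ n + 1 by omega] at ih' e ⊢
    nlinarith [ih', e]

/-- **the count**: `st(2m) = a·m² + 2m` — the grid has `a·m² + 2m + 1` points. -/
theorem st_top : st a n (2 * (n + 1)) = a * (n + 1) ^ 2 + 2 * (n + 1) := by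
  have h := two_st_era1 a n (n + 1) le_rfl
  rw [show n + 1 + (n + 1) = 2 * (n + 1) by ring] at h
  nlinarith [h]

/-- **the tropical row `(m, a+3)`, `m = n + 1`, is at least `a·m² + 2m`.** -/
theorem le_of_tropRootLawAt_succ (B : ℕ) (h : TropRootLawAt (n + 1) (a + 3) B) : a * (n + 1) ^ 2 + 2 * (n + 1) ≤ B := by
  rw [← st_top a n]
  have hmain := h (dd a n) (vv a n) (ee a n) (st a n (2 * (n + 1))) (fun k => th a n (grid a n k).1 (grid a n k).2)
    (fun k => cterm a n (grid a n k).1 (grid a n k).2) (fun r b l => (ee_natAbs a n r b l).le) ?_ ?_ ?_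
  · exact hmain
  · refine Fin.strictMono_iff_lt_succ.mpr fun k => ?_
    simp only [Fin.val_castSucc, Fin.val_succ]
    exact th_grid_lt a n k (by omega)
  · intro k
    obtain ⟨_, h2, h3⟩ := grid_inv a n k (by omega)
    exact isDominant_cterm a n _ _ h3 h2
  · intro k
    simp only [Fin.val_castSucc, Fin.val_succ]
    rw [termSign_grid a n k (by omega), termSign_grid a n (k + 1) (by omega), ← pow_add,
      show (k : ℕ) + (k + 1) = 2 * k + 1 by ring, pow_succ, pow_mul]
    norm_num

end ShiftDiamond

/-- **THE DIAMOND FLOOR: `T(m, K) ≥ (K−3)·m² + 2m` for EVERY `m ≥ 1` and EVERY `K ≥ 3`** (stated with `K = a + 3`): every bound `B` of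
the tropical row `(m, a+3)` satisfies `a·m² + 2m ≤ B`.  The explicit DIAMOND design (exponent type `{0} ∪ {D, …, D+a} ∪ {2D}`, full support,
all `a` low rungs on the middle high level, rotation/era skeleton with a private sign incidence per phase) has `a·m² + 2m + 1`
sign-alternating unique optima — every entry spends its `a` raises exactly once.  Rows: `T(m,4) ≥ m² + 2m` (= SHIFT-SQUARE),
`T(m,5) ≥ 2m² + 2m`, `T(m,6) ≥ 3m² + 2m`, `T(m,7) ≥ 4m² + 2m`, …; at `m = 3`: `T(3,K) ≥ 9K − 21`, at `m = 4`: `T(4,K) ≥ 16K − 40`. -/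
theorem diamond_le_of_tropRootLawAt (a m B : ℕ) (h : TropRootLawAt m (a + 3) B) : a * m ^ 2 + 2 * m ≤ B := by
  rcases m with _ | n
  · simp
  · exact ShiftDiamond.le_of_tropRootLawAt_succ a n B h



end Summit.ValiantsHypothesis.ValiantsHypothesis.Theorems.LacunarySymmetroidMatrixDescartes.TropicalCensus
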